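import Summits.BirchSwinnertonDyer.BirchSwinnertonDyer.Theorems.AlignedTransportAtTwoMainConjectureOfRankZeroBSDAtTwoHalfDescentLayerIndexCertificate
import Summits.BirchSwinnertonDyer.BirchSwinnertonDyer.Theorems.AlignedTransportAtTwoMainConjectureOfRankZeroBSDAtTwoHalfDescentLayerIndexSelmer
import HarnessLib

/-!
# Route `AlignedTransportAtTwo`, crux C2 `MainConjectureOfRankZeroBSDAtTwo` (stmt-BirchSwinnertonDyer-22298):
# THE DESCENT NUMBER WITHOUT GREENBERG 4.14, IV — THE CERTIFICATE IN SELMER CURRENCY: for EVERY Pontryagin-dual datum with `X` finitely generated torsion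
# (any number field, any `ℤ_p`-extension), `0 < #ker(N_n | Sel_{p^∞}(E/K_∞)) < p^{pⁿ(p−1)}` at ANY ONE layer `n` ⟹ `μ(X(E/K_∞)) = 0`
# (route-independent; the `p = 2` composition with the seed of line `birth` is the sequel `…HalfDescentLayerIndexCertificateSeed`)

HONEST FRAMING (cell `bsd-f1-sign2`, WIDTH-5 attached prover seat `bsd-line-att-p5` gen 55 on line `birth` of the lead `bsd-line-att-p2`;
`--supports` stmt-BirchSwinnertonDyer-22298, closes nothing; BSD is NOT proved by any of this; the crux C2, its verdict «blocked-on
`Rank1Residual.GreenbergMuConjectureIrreducible`» and every registered stub (P / T / Kμ / LimDoor / MuIneqʳ / PFμ⁺) are untouched). THEOREMS ONLY — no `def`,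
no instance, no named fact, no `sorry`. Sequel of `…HalfDescentLayerIndexCertificate` (this gen, pure algebra: `0 < #(X/Ψ_nX) < p^{pⁿ(p−1)} ⟹ μ(X) = 0`
for EVERY f.g. torsion `X`, at ANY `n`) composed with g54's `…HalfDescentLayerIndexSelmer` (`#(X/Ψ_nX) = #ker(N_n | Sel_∞)`, g40's Pontryagin pair).

WHAT THIS BUYS FOR C2. g54: MC at the datum ⟺ `#ker N_n = 2^{λ_an}` EXACTLY at the first layer with `2ⁿ > λ_an`, under the binder `hnf`/`prop414` (Greenberg
4.14) and with `λ_an` read off `L₂`. HERE: the `μ`-residue of C2 — the ONLY non-print input of the seed (lead g0–g6: «C2 ⟺ stub T mod PRINT») — follows from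
**ONE INEQUALITY `0 < #ker(N_n | Sel_{2^∞}(W/ℚ_∞)) < 2^{2ⁿ}` at ANY ONE layer `n`**, for every cyclotomic `(κ, γ)`: no Greenberg 4.14, no `λ_an`, no `G`,
no exactness; an upper bound is what a descent produces. It is a CERTIFICATE shape (per curve, like the lead's `TowerGapAtTwo`), not a proof of `μ = 0`.

* §1 (any `K`, `p`, `κ`, `γ`; `D` with `X` f.g. torsion) ★★ `pow_dvd_natCard_endInvariants_relNorm'` (**`p^{pⁿ(p−1)·μ(f)} ∣ #ker N_n`** unconditionally, `(f) = char X`);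
  ★★ `natCard_endInvariants_relNorm_eq_zero_of_dvd` (`Ψ_n ∣ f` ⟹ the kernel is infinite); ★★★ **`mu_eq_zero_of_natCard_endInvariants_relNorm_pos_lt`:
  `0 < #ker N_n < p^{pⁿ(p−1)}` ⟹ `μ(X) = 0`** (`D.mu = 0`).
* Sequel `…HalfDescentLayerIndexCertificateSeed` (`p = 2`, in the route's cone): PRINT + `BSD(W,2)` + (for every cyclotomic `(κ,γ)` some `n` with
  `0 < #ker N_n < 2^{2ⁿ}`) ⟹ `MazurMainConjecture W 2`, and the crux statement by name from PRINT + that certificate on the seed cell.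
Memo `Cruxes/MainConjectureOfRankZeroBSDAtTwo/LAYER-INDEX-FINITE-att-p5-g55.md`. BSD is not proved by any of this; no certificate is computed here for any curve.

References: R. Greenberg, LNM 1716 (1999), §1 pp. 60–65, Conj. 1.11, Thm. 4.1, §4 p. 117 [GreenbergLNM1716]; K. Kato, Astérisque 295 (2004) Thm. 17.4
[Kato2004Asterisque]; L. Washington, GTM 83, §13.3 Thm. 13.13 [Washington1997]; R. L. Miller, LMS J. Comput. Math. 14 (2011) Def. 1.1 [Miller2011LMS].
-/

set_option linter.dupNamespace false
set_option autoImplicit false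

noncomputable section

open scoped Classical AddSubgroup Polynomial

universe u

namespace Summit.BirchSwinnertonDyer.BirchSwinnertonDyer.Theorems.AlignedTransportAtTwoHalfDescentLayerIndexCertificateSelmer

open WeierstrassCurve Literature.NumberTheory.EllipticCurves Literature.NumberTheory.EllipticCurves.IwasawaDual
  Literature.NumberTheory.EllipticCurves.IwasawaAlgebra
  Summit.BirchSwinnertonDyer.Rank1Residual.X1.MuLambda
  Summit.BirchSwinnertonDyer.Rank1Residual.Iwasawa
  Summit.BirchSwinnertonDyer.BirchSwinnertonDyer.Theorems.DefectPrime
  Summit.BirchSwinnertonDyer.BirchSwinnertonDyer.Theorems.AlignedTransportAtTwoCyclotomicLayerPrime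
  Summit.BirchSwinnertonDyer.BirchSwinnertonDyer.Theorems.AlignedTransportAtTwoHalfDescentLayerIndex
  Summit.BirchSwinnertonDyer.BirchSwinnertonDyer.Theorems.AlignedTransportAtTwoHalfDescentLayerIndexSelmer
  Summit.BirchSwinnertonDyer.BirchSwinnertonDyer.Theorems.AlignedTransportAtTwoHalfDescentLayerIndexCertificate

/-! ## §1 Selmer currency: `0 < #ker N_n < p^{pⁿ(p−1)}` at any one layer ⟹ `μ(X) = 0` -/

section Selmer

variable {K : Type u} [Field K] [NumberField K] (W : WeierstrassCurve K) {p : ℕ} [hp : Fact p.Prime] (κ : ZpExtension K p)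
  {γ : Field.absoluteGaloisGroup K}

/-- ★★ **`p^{pⁿ(p−1)·μ(f)} ∣ #ker(N_n | Sel_{p^∞}(E/K_∞))` UNCONDITIONALLY** (`D` any dual datum with `X` f.g. torsion, `char_Λ X = (f)`, any `n`; `Nat.card`,
`N_n = ∑_{i<p}(conj_γ^{pⁿ})^i`). [cite: GreenbergLNM1716, §1 pp. 60–65] [cite: Washington1997, §13.3 Thm. 13.13] -/
theorem pow_dvd_natCard_endInvariants_relNorm' (hγ : κ.IsTopGenerator γ) (D : W.SelmerDualData κ γ) [Module.Finite (IwasawaAlgebra p) D.X]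
    (hD : D.IsTorsion) {f : IwasawaAlgebra p} (hchar : D.charIdeal = Ideal.span {f}) (n : ℕ) :
    p ^ (p ^ n * (p - 1) * mu f) ∣ Nat.card ↥(endInvariants (∑ i ∈ Finset.range p, ((W.conjSelmerInfty κ γ) ^ (p ^ n)) ^ i)) := by
  rw [← natCard_layerQuotient_cyclotomic_eq_natCard_endInvariants W κ hγ D n, ← natDegree_cyclotomicLayer p n]
  exact pow_dvd_natCard_quotient_smul_top' (M := D.X) (cyclotomic_comp_isDistinguishedAt_maximalIdeal p n) (constantCoeff_cyclotomicLayer p n)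
    (prime_coe_cyclotomic_comp p n) hD hchar

/-- ★★ **`Ψ_n ∣ f ⟹ ker(N_n | Sel_{p^∞}(E/K_∞))` IS INFINITE** (`Nat.card = 0`): the layers at which the relative-norm kernel is finite are exactly those with
`Ψ_n ∤ f_X` — detected by the count itself. [cite: GreenbergLNM1716, §1 pp. 60–65] [cite: Washington1997, §13.3] -/
theorem natCard_endInvariants_relNorm_eq_zero_of_dvd (hγ : κ.IsTopGenerator γ) (D : W.SelmerDualData κ γ) [Module.Finite (IwasawaAlgebra p) D.X]
    (hD : D.IsTorsion) {f : IwasawaAlgebra p} (hchar : D.charIdeal = Ideal.span {f}) {n : ℕ}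
    (hdvd : (((Polynomial.cyclotomic (p ^ (n + 1)) ℤ_[p]).comp (Polynomial.X + 1) : ℤ_[p][X]) : IwasawaAlgebra p) ∣ f) :
    Nat.card ↥(endInvariants (∑ i ∈ Finset.range p, ((W.conjSelmerInfty κ γ) ^ (p ^ n)) ^ i)) = 0 := by
  rw [← natCard_layerQuotient_cyclotomic_eq_natCard_endInvariants W κ hγ D n]
  exact natCard_quotient_smul_top_eq_zero_of_dvd (M := D.X) (cyclotomic_comp_isDistinguishedAt_maximalIdeal p n) (prime_coe_cyclotomic_comp p n) hD hchar hdvd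

/-- ★★★ **`μ(X(E/K_∞)) = 0` FROM ONE INEQUALITY ON ONE RELATIVE-NORM KERNEL.** `E/K`, `κ` any `ℤ_p`-extension with topological generator `γ`, `D` any
Pontryagin-dual datum whose `X` is finitely generated torsion (nothing else assumed). If at SOME layer `n`:
**`0 < #{s ∈ Sel_{p^∞}(E/K_∞) : N_n s = 0} < p^{pⁿ(p−1)}`**, then **`μ(X) = 0`** (`D.mu = 0`), and `μ(f) = 0` for every generator `f` of `char_Λ X`.
[cite: GreenbergLNM1716, Conj. 1.11 and §1 pp. 60–65] [cite: Washington1997, §13.3 Thm. 13.13] -/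
theorem mu_eq_zero_of_natCard_endInvariants_relNorm_pos_lt (hγ : κ.IsTopGenerator γ) (D : W.SelmerDualData κ γ) [Module.Finite (IwasawaAlgebra p) D.X]
    (hD : D.IsTorsion) {n : ℕ} (hpos : 0 < Nat.card ↥(endInvariants (∑ i ∈ Finset.range p, ((W.conjSelmerInfty κ γ) ^ (p ^ n)) ^ i)))
    (hlt : Nat.card ↥(endInvariants (∑ i ∈ Finset.range p, ((W.conjSelmerInfty κ γ) ^ (p ^ n)) ^ i)) < p ^ (p ^ n * (p - 1))) :
    D.mu = 0 ∧ ∀ f : IwasawaAlgebra p, D.charIdeal = Ideal.span {f} → mu f = 0 := by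
  rw [← natCard_layerQuotient_cyclotomic_eq_natCard_endInvariants W κ hγ D n] at hpos hlt
  exact ⟨muInvariant_eq_zero_of_natCard_layerQuotient_pos_lt (M := D.X) hD hpos hlt,
    fun f hchar ↦ mu_eq_zero_of_natCard_layerQuotient_pos_lt (M := D.X) hD hchar hpos hlt⟩

end Selmer

end Summit.BirchSwinnertonDyer.BirchSwinnertonDyer.Theorems.AlignedTransportAtTwoHalfDescentLayerIndexCertificateSelmer

end
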